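import Literature.MathematicalPhysics.QuantumFieldTheory.Balaban1983to89.B3Op116RegionSources
import Literature.MathematicalPhysics.QuantumFieldTheory.Balaban1983to89.B3Ineq210RegularRegion
import Literature.MathematicalPhysics.QuantumFieldTheory.Balaban1983to89.B1Ineq225RegularBox
import Literature.MathematicalPhysics.QuantumFieldTheory.Balaban1983to89.B2Eq273NeumannLocality

/-!
# Bałaban, *(Higgs)₂,₃ quantum fields in a finite volume III. Renormalization* [B3] — p. 433 class (c), the cell's Route δ: THE THREE-PIECE
SPLIT `B̃ = B + A + P` OF THE BACKGROUND BY TWO LATTICE CUTOFFS — bookkeeping of the pieces, locality on `□`, and the EXISTENCE of the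
cutoffs from two distance conditions — file «ClassCCutoffs» (the configuration half of the glue `B3Ineq25Op116ClassCSplit`)

statement-level skeleton of published theorems with citation tags; proofs where landed; nothing here is a claim about the Yang–Mills mass gap

T. Bałaban, Commun. Math. Phys. **88** (1983) 411–445 [cite: Balaban1983Higgs3]; part I, Commun. Math. Phys. **85** (1982) 603–636
[cite: Balaban1982Higgs1].  PDFs held: `paper:balaban1983-higgs-2-3-quantum-fields-finite-volume` (journal page = PDF page + 410; p. 412 =
`p0002.txt`, p. 433 = `p0023.txt`).

CITATION HEADER (lean-in-tree rule).  Cell `lit-balaban` (HOME `run/shared/lean/pub/lit-balaban/`), Phase-2 proof seat **p40** gen 78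
(unit `lit-balaban-p40`, literature-prover-lit-balaban-p40-g78-0); free-target protocol G.5-34(d), TAKING line HOME/STATUS.md
2026-08-23T19:46:47Z (the `ClassCSplit` glue; this file is its configuration half, split off so that it builds while the collar members land),
cc r15 (fold owner of B3.Txt@433 / B3.Prop1 / B3.Eq1.16 / B3.Eq2.5), p35, r14; design note `lit-balaban-p40/DESIGN-B3-116-box.md` §5, §9
(HOME/GAPS.md «G-B3-16 ADDENDUM 1»: the cell's RECORDED PROOF-ROUTE DEVIATION for class (c); print's one-piece expansion on `□` is the located
open gap G-B3-16.A1).  No head claim.  USED BY NAME, never restated: r02/p35's `B2Eq273NeumannLocality.propagatorK_congr_of_supported`,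
p40's `B3Op116RegionSources.DeepBlk`, r14's `B3Ineq210RegularRegion.{Interior, Interior.mem, blockUnion_of_isBigBlockUnion}`,
`B1Ineq225RegularBox.{cellBox, isBigBlockUnion_cellBox}`, `B1Ineq234LevelZero.{tdist_triangle_real, tdist_comm, tdist_shift_le_one}`.

## What is printed

[B3] p. 433 [PDF 23] (class (c)), verbatim: *"We take a cube □₁ of size r(L^kε) containing the above cube in the center, and next we take a
cube □ of size 3r(L^kε) and with □₁ in the center. We assume that □₁, □ are sums of big blocks of the unit lattice."* … *"there exists a
constant field B̃₀ such that |B̃ − B̃₀| ≤ O(r(L^kε)p(L^kε)) ≤ O(p(L^kε)²) on the cube □. We have B̃ = B̃₀ + B̃′, and we expand in B̃′ the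
expressions connected with each renormalized class of graphs"*;  p. 412 [PDF 2]: *"dist(supp A, ∂Ω) > 2r(L^kε)"*.  NOT PRINTED (the cell's
Route δ): the cutoffs `χ, ψ`, the three-piece split, the support/distance conditions below.

## What this file proves, and how

Data: `□ = cellBox k K₀ S`, `Ω₂ ⊆ □`, print's background `B̃` ((I.2.23)-regular, `δ_B`), the constant field `B̃₀` (shift-invariant),
`|B̃ − B̃₀| ≤ s` on `supp ψ`, cutoffs `χ, ψ : sites → [0,1]` with steps `≤ l`.  The split (`B̃′ := B̃ − B̃₀`): `P := B̃′·(1−χ)ψ` (COLLAR),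
`A := B̃′·χψ` (CORE), `B := B̃₀ + B̃′·(1−ψ)`.
§1 `cut_step_le` (steps of a cut field `f·g` are `≤ δ + s·l`), the steps of `(1−χ)ψ`, `χψ` (`≤ 2l`);  §2 `sum_eq` (`B + A + P = B̃`),
`core_add_bg_eq` (`A + B = B̃ − P`), `collar_step_le`/`core_step_le` (`δ_P, δ_A ≤ δ_B + 2sl` torus-wide), `collar_abs_le`/`core_abs_le` (`≤ s`),
`bg_eq_of_psi_eq_one`, `bg_step_on_box`, `collar_support` (`P_b ≠ 0 ⇒ χ(b₋) ≠ 1 ∧ ψ(b₋) ≠ 0`), `core_support` (`A_b ≠ 0 ⇒ χ(b₋) ≠ 0 ∧ ψ(b₋) ≠ 0`),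
`sub_collar_eq_core_add` (`B̃ − P = A + B̃₀` where `ψ = 1`);  §3 `propagatorK_bg_eq` (`G_k(□,B)u = G_k(□,B̃₀)u` for sources in `□`);
§4 **`exists_cutoffs`**: `χ := [(R + ℓ − dist(·,Ω₂))/ℓ]₀¹`, `ψ := [(R₂ + ℓ − dist(·,Ω₂))/ℓ]₀¹` are `[0,1]`-valued with steps `≤ ℓ^{−1}`, `ψ = 1`
on `□` and its forward neighbours, `supp χ` deep (with forward neighbours), `{χ ≠ 1}` at distance `≥ R` from `Interior_k(Ω₂)`, `supp ψ` within
distance `< R₂ + ℓ` of `Ω₂` — as soon as every site within distance `R + ℓ + 1` of `Ω₂` is deep in `□` and every site of `□` is within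
distance `R₂ − 1` of `Ω₂` (print's concentric cubes).

## Honest scope

Lattice bookkeeping only (product rule, triangle inequality for (I.1.3), clamped affine profiles); the cutoffs and the split are the cell's
Route δ, not printed objects; `B̃` is taken (I.2.23)-regular torus-wide.  Theorems only: no `def`, no new named fact, no `sorry`; axioms
standard.  Value = bookkeeping of a located member of a by-reference step of B3 — NOT summit progress and nothing about the Yang–Mills mass gap.
-/

noncomputable section

open scoped BigOperators

namespace Literature.MathematicalPhysics.QuantumFieldTheory.Balaban1983to89.B3Op116ClassCCutoffs

open HiggsLattice (ChargeData ScalarField)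
open HiggsCovariance (propagatorK E)
open HiggsCovariancePos (Inside)
open B1Ineq225RegularBox (cellBox isBigBlockUnion_cellBox)
open B3Ineq210RegularRegion (Interior blockUnion_of_isBigBlockUnion)
open B3Op116RegionSources (DeepBlk)
open B2Eq273NeumannLocality (propagatorK_congr_of_supported)

variable {P : HiggsLattice.Params} {N : ℕ}

/-! ## §1 One-step bookkeeping of products with lattice cutoffs -/

section Cut

/-- product rule with the second factor bounded by `1` at the shifted point: `|f′g′ − fg| ≤ |f′ − f| + |f|·|g′ − g|` (plumbing). [folklore] -/
private theorem abs_mul_sub_mul_le {f f' g g' : ℝ} (hg' : |g'| ≤ 1) : |f' * g' - f * g| ≤ |f' - f| + |f| * |g' - g| := by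
  have h : f' * g' - f * g = (f' - f) * g' + f * (g' - g) := by ring
  rw [h]
  refine (abs_add_le _ _).trans (add_le_add ?_ (le_of_eq (abs_mul _ _)))
  rw [abs_mul]
  exact mul_le_of_le_one_right (abs_nonneg _) hg'

/-- product rule with the second factor bounded by `1` at the base point: `|f′g′ − fg| ≤ |f′ − f| + |f′|·|g′ − g|` (plumbing). [folklore] -/
private theorem abs_mul_sub_mul_le' {f f' g g' : ℝ} (hg : |g| ≤ 1) : |f' * g' - f * g| ≤ |f' - f| + |f'| * |g' - g| := by
  have h : f' * g' - f * g = (f' - f) * g + f' * (g' - g) := by ring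
  rw [h]
  refine (abs_add_le _ _).trans (add_le_add ?_ (le_of_eq (abs_mul _ _)))
  rw [abs_mul]
  exact mul_le_of_le_one_right (abs_nonneg _) hg

/-- a number in `[0,1]` has absolute value `≤ 1`, and so has `1 −` it. [folklore] -/
private theorem abs_le_one_of_mem {t : ℝ} (h0 : 0 ≤ t) (h1 : t ≤ 1) : |t| ≤ 1 ∧ |1 - t| ≤ 1 := by
  constructor <;> rw [abs_le] <;> constructor <;> linarith

/-- **THE CUT-PRODUCT STEP BOUND**: if the site function `f` has lattice steps `≤ δ` and `|f| ≤ s` on the support of `g`, and the cutoff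
`g` has `|g| ≤ 1` and steps `≤ l`, then `f·g` has steps `≤ δ + s·l` — the (I.2.23)-regularity bookkeeping of a cut field.
[cite: Balaban1982Higgs1, (2.23) p.610] [cite: Balaban1983Higgs3, p.433] -/
theorem cut_step_le (f g : HiggsLattice.Site P 0 → ℝ) {δ s l : ℝ} (hs : 0 ≤ s) (hl : 0 ≤ l)
    (hf : ∀ (z : HiggsLattice.Site P 0) (ν : Fin P.d), |f (z.shift ν) - f z| ≤ δ) (hfs : ∀ z, g z ≠ 0 → |f z| ≤ s)
    (hg1 : ∀ z, |g z| ≤ 1) (hg : ∀ (z : HiggsLattice.Site P 0) (ν : Fin P.d), |g (z.shift ν) - g z| ≤ l)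
    (z : HiggsLattice.Site P 0) (ν : Fin P.d) :
    |f (z.shift ν) * g (z.shift ν) - f z * g z| ≤ δ + s * l := by
  have hδ : 0 ≤ δ := (abs_nonneg _).trans (hf z ν)
  by_cases hz : g z = 0
  · by_cases hz' : g (z.shift ν) = 0
    · rw [hz, hz', mul_zero, mul_zero, sub_zero, abs_zero]; positivity
    · refine (abs_mul_sub_mul_le' (hg1 z)).trans (add_le_add (hf z ν) ?_)
      exact mul_le_mul (hfs _ hz') (hg z ν) (abs_nonneg _) hs
  · refine (abs_mul_sub_mul_le (hg1 (z.shift ν))).trans (add_le_add (hf z ν) ?_)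
    exact mul_le_mul (hfs _ hz) (hg z ν) (abs_nonneg _) hs

variable (χ ψ : HiggsLattice.Site P 0 → ℝ) {l : ℝ}

/-- steps of the collar cutoff `(1−χ)ψ` are `≤ 2l`. [cite: Balaban1983Higgs3, p.433] -/
theorem collarCut_step_le (hχ01 : ∀ z, 0 ≤ χ z ∧ χ z ≤ 1) (hψ01 : ∀ z, 0 ≤ ψ z ∧ ψ z ≤ 1)
    (hχ : ∀ (z : HiggsLattice.Site P 0) (ν : Fin P.d), |χ (z.shift ν) - χ z| ≤ l)
    (hψ : ∀ (z : HiggsLattice.Site P 0) (ν : Fin P.d), |ψ (z.shift ν) - ψ z| ≤ l) (z : HiggsLattice.Site P 0) (ν : Fin P.d) :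
    |(1 - χ (z.shift ν)) * ψ (z.shift ν) - (1 - χ z) * ψ z| ≤ l + l := by
  refine (abs_mul_sub_mul_le (abs_le_one_of_mem (hψ01 _).1 (hψ01 _).2).1).trans (add_le_add ?_ ?_)
  · rw [show (1 - χ (z.shift ν)) - (1 - χ z) = -(χ (z.shift ν) - χ z) by ring, abs_neg]; exact hχ z ν
  · calc |1 - χ z| * |ψ (z.shift ν) - ψ z| ≤ 1 * l :=
          mul_le_mul (abs_le_one_of_mem (hχ01 z).1 (hχ01 z).2).2 (hψ z ν) (abs_nonneg _) zero_le_one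
      _ = l := one_mul l

/-- steps of the core cutoff `χψ` are `≤ 2l`. [cite: Balaban1983Higgs3, p.433] -/
theorem coreCut_step_le (hχ01 : ∀ z, 0 ≤ χ z ∧ χ z ≤ 1) (hψ01 : ∀ z, 0 ≤ ψ z ∧ ψ z ≤ 1)
    (hχ : ∀ (z : HiggsLattice.Site P 0) (ν : Fin P.d), |χ (z.shift ν) - χ z| ≤ l)
    (hψ : ∀ (z : HiggsLattice.Site P 0) (ν : Fin P.d), |ψ (z.shift ν) - ψ z| ≤ l) (z : HiggsLattice.Site P 0) (ν : Fin P.d) :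
    |χ (z.shift ν) * ψ (z.shift ν) - χ z * ψ z| ≤ l + l := by
  refine (abs_mul_sub_mul_le (abs_le_one_of_mem (hψ01 _).1 (hψ01 _).2).1).trans (add_le_add (hχ z ν) ?_)
  calc |χ z| * |ψ (z.shift ν) - ψ z| ≤ 1 * l :=
        mul_le_mul (abs_le_one_of_mem (hχ01 z).1 (hχ01 z).2).1 (hψ z ν) (abs_nonneg _) zero_le_one
    _ = l := one_mul l

/-- the collar and core cutoffs take values in `[−1,1]`. [cite: Balaban1983Higgs3, p.433] -/
theorem cut_abs_le_one (hχ01 : ∀ z, 0 ≤ χ z ∧ χ z ≤ 1) (hψ01 : ∀ z, 0 ≤ ψ z ∧ ψ z ≤ 1) (z : HiggsLattice.Site P 0) :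
    |(1 - χ z) * ψ z| ≤ 1 ∧ |χ z * ψ z| ≤ 1 := by
  have h1 := abs_le_one_of_mem (hχ01 z).1 (hχ01 z).2
  have h2 := abs_le_one_of_mem (hψ01 z).1 (hψ01 z).2
  constructor
  · rw [abs_mul]; exact mul_le_one₀ h1.2 (abs_nonneg _) h2.1
  · rw [abs_mul]; exact mul_le_one₀ h1.1 (abs_nonneg _) h2.1

end Cut

/-! ## §2 The three pieces of the background and their bookkeeping -/

section Pieces

variable (Bt B0 Pc A B : HiggsLattice.VecField P 0) (χ ψ : HiggsLattice.Site P 0 → ℝ)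
  (hPc : ∀ b : HiggsLattice.PBond P 0, Pc b = (Bt b - B0 b) * ((1 - χ b.src) * ψ b.src))
  (hA : ∀ b : HiggsLattice.PBond P 0, A b = (Bt b - B0 b) * (χ b.src * ψ b.src))
  (hB : ∀ b : HiggsLattice.PBond P 0, B b = B0 b + (Bt b - B0 b) * (1 - ψ b.src))
include hPc hA hB

/-- **`B + A + P = B̃`** identically (`(1−ψ) + χψ + (1−χ)ψ = 1`). [cite: Balaban1983Higgs3, p.433 «B̃ = B̃₀ + B̃′»] -/
theorem sum_eq : B + A + Pc = Bt := by
  funext b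
  simp only [Pi.add_apply, hPc b, hA b, hB b]
  ring

/-- **`A + B = B̃ − P`**: the third piece `B` completes the core part to the collar member's background `Y = B̃ − P` (on the bonds from `□`,
`B = B̃₀`: `bg_eq_of_psi_eq_one`, §4 `sub_collar_eq_core_add`). [cite: Balaban1983Higgs3, p.433] -/
theorem core_add_bg_eq : A + B = Bt - Pc := by
  rw [← sum_eq Bt B0 Pc A B χ ψ hPc hA hB]
  funext b
  simp only [Pi.add_apply, Pi.sub_apply]
  ring

omit hPc hA in
/-- `B = B̃₀` on the bonds from the sites where `ψ = 1`. [cite: Balaban1983Higgs3, p.433 «a constant field B̃₀»] -/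
theorem bg_eq_of_psi_eq_one {b : HiggsLattice.PBond P 0} (h : ψ b.src = 1) : B b = B0 b := by
  rw [hB b, h, sub_self, mul_zero, add_zero]

omit hPc hA in
/-- `B` is (I.2.23)-regular with `δ = 0` at the sites where `ψ = 1` together with the forward neighbours, `B̃₀` being shift-invariant.
[cite: Balaban1982Higgs1, (2.23) p.610] [cite: Balaban1983Higgs3, p.433] -/
theorem bg_step_on_box (hB0 : ∀ (z : HiggsLattice.Site P 0) (μ ν : Fin P.d), B0 ⟨z.shift ν, μ⟩ = B0 ⟨z, μ⟩)
    {z : HiggsLattice.Site P 0} (hz : ψ z = 1) (hz' : ∀ ν : Fin P.d, ψ (z.shift ν) = 1) (μ ν : Fin P.d) :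
    |B ⟨z.shift ν, μ⟩ - B ⟨z, μ⟩| ≤ 0 := by
  rw [bg_eq_of_psi_eq_one (Bt := Bt) (B0 := B0) (B := B) (ψ := ψ) hB (b := ⟨z.shift ν, μ⟩) (hz' ν),
    bg_eq_of_psi_eq_one (Bt := Bt) (B0 := B0) (B := B) (ψ := ψ) hB (b := ⟨z, μ⟩) hz, hB0, sub_self, abs_zero]

omit hA hB in
/-- support of the collar part: `P_b ≠ 0 ⇒ χ(b₋) ≠ 1 ∧ ψ(b₋) ≠ 0`. [cite: Balaban1983Higgs3, p.433] -/
theorem collar_support {b : HiggsLattice.PBond P 0} (h : Pc b ≠ 0) : χ b.src ≠ 1 ∧ ψ b.src ≠ 0 := by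
  rw [hPc b] at h
  constructor
  · intro h1; apply h; rw [h1, sub_self, zero_mul, mul_zero]
  · intro h0; apply h; rw [h0, mul_zero, mul_zero]

omit hPc hB in
/-- support of the core part: `A_b ≠ 0 ⇒ χ(b₋) ≠ 0 ∧ ψ(b₋) ≠ 0`. [cite: Balaban1983Higgs3, p.433, p.412] -/
theorem core_support {b : HiggsLattice.PBond P 0} (h : A b ≠ 0) : χ b.src ≠ 0 ∧ ψ b.src ≠ 0 := by
  rw [hA b] at h
  constructor
  · intro h1; apply h; rw [h1, zero_mul, mul_zero]
  · intro h0; apply h; rw [h0, mul_zero, mul_zero]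

variable {δB s l : ℝ} (hs : 0 ≤ s) (hl : 0 ≤ l)
  (hB0 : ∀ (z : HiggsLattice.Site P 0) (μ ν : Fin P.d), B0 ⟨z.shift ν, μ⟩ = B0 ⟨z, μ⟩)
  (hregBt : ∀ (z : HiggsLattice.Site P 0) (μ ν : Fin P.d), |Bt ⟨z.shift ν, μ⟩ - Bt ⟨z, μ⟩| ≤ δB)
  (hsz : ∀ (z : HiggsLattice.Site P 0) (μ : Fin P.d), ψ z ≠ 0 → |Bt ⟨z, μ⟩ - B0 ⟨z, μ⟩| ≤ s)
  (hχ01 : ∀ z, 0 ≤ χ z ∧ χ z ≤ 1) (hψ01 : ∀ z, 0 ≤ ψ z ∧ ψ z ≤ 1)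
  (hχ : ∀ (z : HiggsLattice.Site P 0) (ν : Fin P.d), |χ (z.shift ν) - χ z| ≤ l)
  (hψ : ∀ (z : HiggsLattice.Site P 0) (ν : Fin P.d), |ψ (z.shift ν) - ψ z| ≤ l)
include hB0 hregBt

omit hPc hA hB in
/-- `B̃′ = B̃ − B̃₀` has the steps of `B̃` (`B̃₀` shift-invariant). [cite: Balaban1982Higgs1, (2.23) p.610] [cite: Balaban1983Higgs3, p.433] -/
theorem fluct_step_le (z : HiggsLattice.Site P 0) (μ ν : Fin P.d) :
    |(Bt ⟨z.shift ν, μ⟩ - B0 ⟨z.shift ν, μ⟩) - (Bt ⟨z, μ⟩ - B0 ⟨z, μ⟩)| ≤ δB := by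
  rw [hB0, show Bt ⟨z.shift ν, μ⟩ - B0 ⟨z, μ⟩ - (Bt ⟨z, μ⟩ - B0 ⟨z, μ⟩) = Bt ⟨z.shift ν, μ⟩ - Bt ⟨z, μ⟩ by ring]
  exact hregBt z μ ν

include hs hl hsz hχ01 hψ01 hχ hψ

omit hA hB in
/-- **the collar part is (I.2.23)-regular torus-wide with `δ_P ≤ δ_B + s·2l`**. [cite: Balaban1982Higgs1, (2.23) p.610] [cite: Balaban1983Higgs3, p.433] -/
theorem collar_step_le (z : HiggsLattice.Site P 0) (μ ν : Fin P.d) : |Pc ⟨z.shift ν, μ⟩ - Pc ⟨z, μ⟩| ≤ δB + s * (l + l) := by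
  rw [hPc, hPc]
  exact cut_step_le (fun w => Bt ⟨w, μ⟩ - B0 ⟨w, μ⟩) (fun w => (1 - χ w) * ψ w) hs (add_nonneg hl hl)
    (fun w ν' => fluct_step_le Bt B0 hB0 hregBt w μ ν')
    (fun w hw => hsz w μ fun h0 => hw (by rw [h0, mul_zero])) (fun w => (cut_abs_le_one χ ψ hχ01 hψ01 w).1)
    (collarCut_step_le χ ψ hχ01 hψ01 hχ hψ) z ν

omit hPc hB in
/-- **the core part is (I.2.23)-regular torus-wide with `δ_A ≤ δ_B + s·2l`**. [cite: Balaban1982Higgs1, (2.23) p.610] [cite: Balaban1983Higgs3, p.433] -/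
theorem core_step_le (z : HiggsLattice.Site P 0) (μ ν : Fin P.d) : |A ⟨z.shift ν, μ⟩ - A ⟨z, μ⟩| ≤ δB + s * (l + l) := by
  rw [hA, hA]
  exact cut_step_le (fun w => Bt ⟨w, μ⟩ - B0 ⟨w, μ⟩) (fun w => χ w * ψ w) hs (add_nonneg hl hl)
    (fun w ν' => fluct_step_le Bt B0 hB0 hregBt w μ ν')
    (fun w hw => hsz w μ fun h0 => hw (by rw [h0, mul_zero])) (fun w => (cut_abs_le_one χ ψ hχ01 hψ01 w).2)
    (coreCut_step_le χ ψ hχ01 hψ01 hχ hψ) z ν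

omit hl hB0 hregBt hχ hψ hA hB in
/-- `|P_b| ≤ s`. [cite: Balaban1983Higgs3, p.433 «|B̃ − B̃₀| ≤ O(r(L^kε)p(L^kε))»] -/
theorem collar_abs_le (b : HiggsLattice.PBond P 0) : |Pc b| ≤ s := by
  rw [hPc b, abs_mul]
  by_cases h0 : ψ b.src = 0
  · rw [h0, mul_zero, abs_zero, mul_zero]; exact hs
  · exact (mul_le_of_le_one_right (abs_nonneg _) (cut_abs_le_one χ ψ hχ01 hψ01 b.src).1).trans (hsz b.src b.dir h0)

omit hl hB0 hregBt hχ hψ hPc hB in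
/-- `|A_b| ≤ s`. [cite: Balaban1983Higgs3, p.433 «|B̃ − B̃₀| ≤ O(r(L^kε)p(L^kε))»] -/
theorem core_abs_le (b : HiggsLattice.PBond P 0) : |A b| ≤ s := by
  rw [hA b, abs_mul]
  by_cases h0 : ψ b.src = 0
  · rw [h0, mul_zero, abs_zero, mul_zero]; exact hs
  · exact (mul_le_of_le_one_right (abs_nonneg _) (cut_abs_le_one χ ψ hχ01 hψ01 b.src).2).trans (hsz b.src b.dir h0)

end Pieces

/-! ## §3 Locality: the core expansion is around print's `G_k(□, B̃₀)` -/

section Locality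

variable (C : ChargeData N)

/-- **`G_k(□,B)u = G_k(□,B̃₀)u` for sources `u` supported in `□`** when `B = B̃₀` on the bonds from the sites of `□` (`m² > 0`, `a_k ≥ 0`,
`k ≤ K`): r02/p35's locality of the propagator in the field. [cite: Balaban1982Higgs1, (2.20) p.610] [cite: Balaban1983Higgs3, p.433] -/
theorem propagatorK_bg_eq {k K₀ : ℕ} (hk : k ≤ P.K) {msq a : ℝ} (hmsq : 0 < msq) (hak : 0 ≤ B1.aSeq a P.L k)
    (S : Fin P.d → Finset ℕ) {B B0 : HiggsLattice.VecField P 0}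
    (hBB0 : ∀ b : HiggsLattice.PBond P 0, b.src ∈ cellBox k K₀ S → B b = B0 b)
    (u : ScalarField P 0 N) (hu : ∀ x, x ∉ cellBox k K₀ S → u x = 0) :
    propagatorK C (cellBox k K₀ S) B msq a k u = propagatorK C (cellBox k K₀ S) B0 msq a k u :=
  propagatorK_congr_of_supported C hmsq hak (blockUnion_of_isBigBlockUnion le_rfl (isBigBlockUnion_cellBox S)) hk
    (fun b hb => hBB0 b hb.1) u hu

end Locality

section Link

/-- on the bonds from `□` (where `ψ = 1`) the collar member's background `B̃ − P` IS the core member's `A + B̃₀`.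
[cite: Balaban1983Higgs3, p.433 «B̃ = B̃₀ + B̃′»] -/
theorem sub_collar_eq_core_add (Bt B0 Pc A : HiggsLattice.VecField P 0) (χ ψ : HiggsLattice.Site P 0 → ℝ)
    (hPc : ∀ b : HiggsLattice.PBond P 0, Pc b = (Bt b - B0 b) * ((1 - χ b.src) * ψ b.src))
    (hA : ∀ b : HiggsLattice.PBond P 0, A b = (Bt b - B0 b) * (χ b.src * ψ b.src))
    {b : HiggsLattice.PBond P 0} (h : ψ b.src = 1) : (Bt - Pc) b = (A + B0) b := by
  simp only [Pi.sub_apply, Pi.add_apply, hPc b, hA b, h]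
  ring

end Link

/-! ## §4 Existence of the cutoffs: clamped affine profiles of the lattice distance to `Ω₂` -/

section Cutoffs

open B1Ineq234LevelZero (tdist_triangle_real tdist_comm tdist_shift_le_one)

/-- the clamp `[t]₀¹ = max 0 (min 1 t)` takes values in `[0,1]` (plumbing). [folklore] -/
private theorem clamp_mem (t : ℝ) : 0 ≤ max 0 (min 1 t) ∧ max 0 (min 1 t) ≤ 1 :=
  ⟨le_max_left _ _, max_le zero_le_one (min_le_left _ _)⟩

/-- the clamp is `1`-Lipschitz (plumbing). [folklore] -/
private theorem abs_clamp_sub_clamp_le (a b : ℝ) : |max 0 (min 1 a) - max 0 (min 1 b)| ≤ |a - b| := by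
  have h1 : |max 0 (min 1 a) - max 0 (min 1 b)| ≤ |min 1 a - min 1 b| := by
    have h := abs_max_sub_max_le_abs (min 1 a) (min 1 b) 0
    rwa [max_comm (min 1 a), max_comm (min 1 b)] at h
  refine h1.trans ?_
  have h2 := abs_min_sub_min_le_max 1 a 1 b
  rwa [sub_self, abs_zero, max_eq_right (abs_nonneg _)] at h2

/-- the clamp is `1` at arguments `≥ 1` (plumbing). [folklore] -/
private theorem clamp_eq_one {t : ℝ} (h : 1 ≤ t) : max 0 (min 1 t) = 1 := by
  rw [min_eq_left h, max_eq_right zero_le_one]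

/-- a nonzero clamp has a positive argument (plumbing). [folklore] -/
private theorem pos_of_clamp_ne_zero {t : ℝ} (h : max 0 (min 1 t) ≠ 0) : 0 < t := by
  by_contra hle
  have hle' : t ≤ 0 := not_lt.mp hle
  exact h (by rw [min_eq_right (hle'.trans zero_le_one), max_eq_left hle'])

/-- a clamp `≠ 1` has an argument `< 1` (plumbing). [folklore] -/
private theorem lt_one_of_clamp_ne_one {t : ℝ} (h : max 0 (min 1 t) ≠ 1) : t < 1 := by
  by_contra hle
  exact h (clamp_eq_one (not_lt.mp hle))

/-- **EXISTENCE OF THE CUTOFFS OF §4 FROM TWO DISTANCE CONDITIONS BETWEEN `Ω₂` AND `□`** (print's concentric cubes `□₁ ⊂ □`, p. 433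
verbatim: *"We take a cube □₁ of size r(L^kε) containing the above cube in the center, and next we take a cube □ of size 3r(L^kε) and with
□₁ in the center. We assume that □₁, □ are sums of big blocks of the unit lattice."*): if every site within lattice
distance `R + ℓ + 1` of `Ω₂` is a deep site of `□ = cellBox k K₀ S`, and every site of `□` is within distance `R₂ − 1` of `Ω₂`, then
`χ := [(R + ℓ − dist(·,Ω₂))/ℓ]₀¹`, `ψ := [(R₂ + ℓ − dist(·,Ω₂))/ℓ]₀¹` are cutoffs with values in `[0,1]`, steps `≤ ℓ^{−1}`, `ψ = 1` on `□` and
its forward neighbours, `supp χ` deep (with forward neighbours), `{χ ≠ 1}` at distance `≥ R` from `Interior_k(Ω₂)`, and `supp ψ` within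
distance `< R₂ + ℓ` of `Ω₂` (where the caller controls `|B̃ − B̃₀|`).  [cite: Balaban1983Higgs3, p.433] [cite: Balaban1982Higgs1, (1.3) p.604] -/
theorem exists_cutoffs {k K₀ : ℕ} (S : Fin P.d → Finset ℕ) {Ω₂ : Finset (HiggsLattice.Site P 0)} (hne : Ω₂.Nonempty)
    {R ℓ R₂ : ℝ} (hℓ : 0 < ℓ)
    (hdeep : ∀ (z y : HiggsLattice.Site P 0), y ∈ Ω₂ → (HiggsLattice.Site.tdist y z : ℝ) ≤ R + ℓ + 1 →
      DeepBlk k K₀ (cellBox k K₀ S) z)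
    (hbox : ∀ z ∈ cellBox k K₀ S, ∃ y ∈ Ω₂, (HiggsLattice.Site.tdist y z : ℝ) + 1 ≤ R₂) :
    ∃ χ ψ : HiggsLattice.Site P 0 → ℝ,
      (∀ z, 0 ≤ χ z ∧ χ z ≤ 1) ∧ (∀ z, 0 ≤ ψ z ∧ ψ z ≤ 1) ∧
      (∀ (z : HiggsLattice.Site P 0) (ν : Fin P.d), |χ (z.shift ν) - χ z| ≤ ℓ⁻¹) ∧
      (∀ (z : HiggsLattice.Site P 0) (ν : Fin P.d), |ψ (z.shift ν) - ψ z| ≤ ℓ⁻¹) ∧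
      (∀ z ∈ cellBox k K₀ S, ψ z = 1 ∧ ∀ ν : Fin P.d, ψ (z.shift ν) = 1) ∧
      (∀ z : HiggsLattice.Site P 0, χ z ≠ 0 → ψ z ≠ 0 →
        DeepBlk k K₀ (cellBox k K₀ S) z ∧ ∀ μ : Fin P.d, DeepBlk k K₀ (cellBox k K₀ S) (z.shift μ)) ∧
      (∀ z : HiggsLattice.Site P 0, χ z ≠ 1 → ψ z ≠ 0 →
        ∀ x : HiggsLattice.Site P 0, Interior k K₀ Ω₂ x → R ≤ (HiggsLattice.Site.tdist x z : ℝ)) ∧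
      (∀ z : HiggsLattice.Site P 0, ψ z ≠ 0 → ∃ y ∈ Ω₂, (HiggsLattice.Site.tdist y z : ℝ) < R₂ + ℓ) := by
  classical
  -- the lattice distance to `Ω₂`, abstracted by its two defining properties
  have hD : ∃ D : HiggsLattice.Site P 0 → ℝ, (∀ z, ∀ y ∈ Ω₂, D z ≤ (HiggsLattice.Site.tdist y z : ℝ)) ∧
      (∀ z, ∃ y ∈ Ω₂, D z = (HiggsLattice.Site.tdist y z : ℝ)) := by
    refine ⟨fun z => ((Ω₂.inf' hne fun y => HiggsLattice.Site.tdist y z : ℕ) : ℝ), fun z y hy => ?_, fun z => ?_⟩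
    · dsimp only
      exact_mod_cast Finset.inf'_le (fun y => HiggsLattice.Site.tdist y z) hy
    · obtain ⟨y, hy, h⟩ := Finset.exists_mem_eq_inf' hne (fun y => HiggsLattice.Site.tdist y z)
      refine ⟨y, hy, ?_⟩
      dsimp only
      exact_mod_cast h
  obtain ⟨D, hDle, hDmem⟩ := hD
  have hD1 : ∀ (z : HiggsLattice.Site P 0) (ν : Fin P.d), D (z.shift ν) ≤ D z + 1 := by
    intro z ν
    obtain ⟨y, hy, h⟩ := hDmem z
    have h1 := hDle (z.shift ν) y hy
    have h2 := tdist_triangle_real y z (z.shift ν)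
    have h3 : (HiggsLattice.Site.tdist z (z.shift ν) : ℝ) ≤ 1 := by exact_mod_cast tdist_shift_le_one z ν
    linarith
  have hD2 : ∀ (z : HiggsLattice.Site P 0) (ν : Fin P.d), D z ≤ D (z.shift ν) + 1 := by
    intro z ν
    obtain ⟨y, hy, h⟩ := hDmem (z.shift ν)
    have h1 := hDle z y hy
    have h2 := tdist_triangle_real y (z.shift ν) z
    have h3 : (HiggsLattice.Site.tdist (z.shift ν) z : ℝ) ≤ 1 := by
      rw [tdist_comm]; exact_mod_cast tdist_shift_le_one z ν
    linarith
  have hDabs : ∀ (z : HiggsLattice.Site P 0) (ν : Fin P.d), |D (z.shift ν) - D z| ≤ 1 :=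
    fun z ν => abs_sub_le_iff.2 ⟨by linarith [hD1 z ν], by linarith [hD2 z ν]⟩
  have hstep : ∀ (T : ℝ) (z : HiggsLattice.Site P 0) (ν : Fin P.d),
      |max 0 (min 1 ((T + ℓ - D (z.shift ν)) / ℓ)) - max 0 (min 1 ((T + ℓ - D z) / ℓ))| ≤ ℓ⁻¹ := by
    intro T z ν
    refine (abs_clamp_sub_clamp_le _ _).trans ?_
    rw [show (T + ℓ - D (z.shift ν)) / ℓ - (T + ℓ - D z) / ℓ = -((D (z.shift ν) - D z) * ℓ⁻¹) by ring, abs_neg, abs_mul,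
      abs_of_pos (inv_pos.2 hℓ)]
    exact mul_le_of_le_one_left (inv_pos.2 hℓ).le (hDabs z ν)
  have hlt : ∀ (T : ℝ) (z : HiggsLattice.Site P 0), max 0 (min 1 ((T + ℓ - D z) / ℓ)) ≠ 0 → D z < T + ℓ := by
    intro T z h
    have h' := (lt_div_iff₀ hℓ).1 (pos_of_clamp_ne_zero h)
    rw [zero_mul] at h'
    linarith
  refine ⟨fun z => max 0 (min 1 ((R + ℓ - D z) / ℓ)), fun z => max 0 (min 1 ((R₂ + ℓ - D z) / ℓ)), fun z => clamp_mem _,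
    fun z => clamp_mem _, hstep R, hstep R₂, fun z hz => ?_, fun z hχ _ => ?_, fun z hχ _ x hx => ?_, fun z hψ => ?_⟩
  · -- `ψ = 1` on `□` and its forward neighbours
    obtain ⟨y, hy, hyz⟩ := hbox z hz
    have h0 := hDle z y hy
    refine ⟨clamp_eq_one ?_, fun ν => clamp_eq_one ?_⟩
    · rw [le_div_iff₀ hℓ]; linarith
    · rw [le_div_iff₀ hℓ]; linarith [hD1 z ν]
  · -- `supp χ` is deep, with its forward neighbours
    obtain ⟨y, hy, hDy⟩ := hDmem z
    have hz := hlt R z hχ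
    refine ⟨hdeep z y hy (by linarith), fun μ => hdeep (z.shift μ) y hy ?_⟩
    have h2 := tdist_triangle_real y z (z.shift μ)
    have h3 : (HiggsLattice.Site.tdist z (z.shift μ) : ℝ) ≤ 1 := by exact_mod_cast tdist_shift_le_one z μ
    linarith
  · -- `{χ ≠ 1}` is at distance `≥ R` from the interior points of `Ω₂`
    have h' := (div_lt_iff₀ hℓ).1 (lt_one_of_clamp_ne_one hχ)
    rw [one_mul] at h'
    have h0 := hDle z x hx.mem
    linarith
  · -- `supp ψ` lies within distance `< R₂ + ℓ` of `Ω₂`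
    obtain ⟨y, hy, hDy⟩ := hDmem z
    exact ⟨y, hy, by linarith [hlt R₂ z hψ]⟩

end Cutoffs

end Literature.MathematicalPhysics.QuantumFieldTheory.Balaban1983to89.B3Op116ClassCCutoffs

end
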